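import Literature.Analysis.OperatorTheory.YangMillsMatrixModelValleyBound
import Literature.Analysis.OperatorTheory.YangMillsMatrixModelLevels
import Literature.Analysis.OperatorTheory.YangMillsMatrixModelEigenfunctions
import Mathlib.Analysis.SpecialFunctions.JapaneseBracket
import HarnessLib

/-!
# The cut-off energy identity `𝔮(χF) = ∫ χ² F·(𝔥F) + ½ ∫ |∇χ|² F²` for Lüscher's matrix-model form — PROVED

Topic `Literature/Analysis/OperatorTheory`, a proofs sibling of `YangMillsMatrixModelDiscreteSpectrum.lean`
(`energyForm 𝔮(ψ) = ∫ ½‖∇ψ‖² + V ψ²` on `ℝ⁹`, `IsTestFn` = `C²_c`) and `…ValleyBound.lean` (`pderiv p = ∂_p`,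
`norm_gradient_sq`).

Source.  S. Agmon, *Lectures on Exponential Decay of Solutions of Second-Order Elliptic Equations* (Princeton
Math. Notes 29, 1982), Ch. 1, proof of the Main Theorem 1.5, identity **(1.16)**:
`Re[∇v · ∇(ψ² v̄)] = |∇(ψv)|² − |v|²|∇ψ|²`, and its integrated form **(1.16″)** (held copy p0014–p0015):
for a solution `u` of `Au + qu = f`,  `∫ [|∇(ψu)|² − |u|²|∇ψ|² + Re q |u|²ψ²] dx = Re ∫ f ū ψ² dx`
(`ψ` real Lipschitz of compact support) — the localisation identity behind Agmon estimates, the IMS formula,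
and every quasimode (cut-off eigenfunction) computation.

What is proved here, for the tree's form `𝔮` (`A = −½Δ`, `q = V`): for every `C²_c` cut-off `χ` (`IsTestFn χ`)
and every `C²` function `F` on `ℝ⁹` (no decay or integrability needed — `χ` localises everything):

* `integral_cutoff_ibp` — the one-coordinate integration by parts
  `∫ [χ²(∂_pF)² + F·(2χ ∂_pχ ∂_pF + χ² ∂_p∂_pF)] = 0` (no boundary terms);
* ★ `energyForm_testFn_mul` — **`𝔮(χF) = ∫ χ² F·(−½ΔF + VF) + ½ ∫ ‖∇χ‖² F²`**, `ΔF = Σ_p ∂_p∂_pF`;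
* `energyForm_testFn_mul_of_eigen` — if moreover `−½ΔF + VF = E·F` pointwise (a classical eigenfunction, e.g.
  the `f_j` of the named fact `LuscherHamiltonianEigenfunctions`), then **`𝔮(χF) = E ∫ χ²F² + ½ ∫ ‖∇χ‖² F²`** —
  the energy of a cut-off eigenfunction exceeds `E‖χF‖²` exactly by the localisation cost `½∫|∇χ|²F²`;
* `energyForm_testFn_mul_eigenfunction` / `LuscherHamiltonianEigenfunctions.exists_cutoff_energy` — the same for
  the eigenfunctions `f_j` of the named fact `LuscherHamiltonianEigenfunctions` (`YangMillsMatrixModelEigenfunctions.lean`,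
  clause `hApply f_j = physLevel (j+1) · f_j`): `𝔮(χ f_j) = physLevel (j+1) · l2sq (χ f_j) + ½ ∫ ‖∇χ‖² f_j²` — the
  `ℝ⁹`-side quasimode energy used before pull-back to the gauge group (AL2 of `stub_absLower`, crux ONE).

* §5 **the SPAN (quasimode-space) version** [Helffer 1988, §4.1–4.2, Prop. 4.1.1 / Thm. 4.2.1: the space spanned by
  cut-off eigenfunctions `Ψ_{j,k} = χ_j φ_{j,k}`, their almost-orthonormality (4.2.13) and energies]: for
  `F_a = Σ_j a_j f_j` — `pderiv_sum_mul`, `hApply_sum_mul` (linearity), `energyForm_testFn_mul_span`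
  (`𝔮(χF_a) = Σ_{i,j} a_i a_j (E_j ∫χ²f_if_j + ½∫‖∇χ‖²f_if_j)`), `l2sq_testFn_mul_span`, the Gram identity
  `∫ χ² f_i f_j = δ_ij − ∫ (1−χ²) f_i f_j` (`integral_sq_mul_mul_eq_of_orthonormal`), and the **quasimode Rayleigh
  bound** `energyForm_span_le`: `𝔮(χF_a) ≤ E·l2sq(χF_a) + Σ_{i,j}|a_i||a_j|((E − E_j)|T_ij| + ½|D_ij|)` whenever all
  `E_j ≤ E`, with the tails `T_ij = ∫(1−χ²)f_if_j`, `D_ij = ∫‖∇χ‖²f_if_j`; and `sum_sq_sub_le_l2sq_span`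
  (`Σ a_j² − Σ|a_i||a_j||T_ij| ≤ l2sq(χF_a)`, non-degeneracy of the trial space);
* §6 **exponential tails** [Agmon 1982 Cor. 4.5 / Thm. 5.1 ⇒ the decay clause `ExpDecay₂`; Helffer 1988 (4.2.13)]:
  `integrable_exp_neg_norm` (`e^{−‖x‖} ∈ L¹(ℝ⁹)`), `abs_integral_weight_mul_mul_le` (|∫ w f_i f_j| ≤ M C_i C_j e^{−R} ∫e^{−‖x‖}
  for `|w| ≤ M` vanishing on `‖x‖ < R` and `|f| ≤ C e^{−‖x‖}`), and its instances for the two tails of §5 when the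
  cut-off equals `1` on the ball `‖x‖ < R`: `abs_tail_le` (`T_ij`) and `abs_gradTail_le` (`D_ij`) — both `O(e^{−R})`.

No definitions, no named facts, 0 sorry.
-/

noncomputable section

open MeasureTheory Filter Topology Function
open scoped BigOperators

namespace Literature.Analysis.OperatorTheory.YMMatrixModel

section CutoffEnergy

variable {χ F : ZM → ℝ}

/-! ### 1. Calculus of `C²` functions in the coordinates `∂_p` -/

/-- Product rule for line derivatives of real functions. [cite: Agmon1982, (1.16)] -/
private theorem hasLineDerivAt_mul₂ {f g : ZM → ℝ} {f' g' : ℝ} {x v : ZM}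
    (hf : HasLineDerivAt ℝ f f' x v) (hg : HasLineDerivAt ℝ g g' x v) :
    HasLineDerivAt ℝ (fun y => f y * g y) (f' * g x + f x * g') x v := by
  unfold HasLineDerivAt at hf hg ⊢
  have h := hf.mul hg
  simp only [zero_smul, add_zero] at h
  exact h

/-- A differentiable function has `∂_p` as its line derivative along `e_p`. [cite: Agmon1982, (1.16)] -/
theorem hasLineDerivAt_pderiv {ψ : ZM → ℝ} (hψ : Differentiable ℝ ψ) (x : ZM) (p : Fin 3 × Fin 3) :
    HasLineDerivAt ℝ ψ (pderiv p ψ x) x (unitDir p) :=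
  (hψ x).hasFDerivAt.hasLineDerivAt (unitDir p)

/-- A `C²` function is differentiable. [cite: Agmon1982, Thm. 1.5] -/
theorem differentiable_of_contDiff_two (hF : ContDiff ℝ 2 F) : Differentiable ℝ F :=
  hF.differentiable (by norm_num)

/-- The partials of a `C²` function are `C¹`. [cite: Agmon1982, Thm. 1.5] -/
theorem contDiff_one_pderiv (hF : ContDiff ℝ 2 F) (p : Fin 3 × Fin 3) : ContDiff ℝ 1 (pderiv p F) := by
  have h1 : ContDiff ℝ 1 (fderiv ℝ F) := hF.fderiv_right (le_of_eq one_add_one_eq_two)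
  exact h1.clm_apply contDiff_const

/-- The partials of a `C²` function are continuous. [cite: Agmon1982, Thm. 1.5] -/
theorem continuous_pderiv_of_contDiff_two (hF : ContDiff ℝ 2 F) (p : Fin 3 × Fin 3) :
    Continuous (pderiv p F) :=
  (contDiff_one_pderiv hF p).continuous

/-- The partials of a `C²` function are differentiable. [cite: Agmon1982, Thm. 1.5] -/
theorem differentiable_pderiv_of_contDiff_two (hF : ContDiff ℝ 2 F) (p : Fin 3 × Fin 3) :
    Differentiable ℝ (pderiv p F) :=
  (contDiff_one_pderiv hF p).differentiable one_ne_zero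

/-- The second partials of a `C²` function are continuous. [cite: Agmon1982, Thm. 1.5] -/
theorem continuous_pderiv_pderiv_of_contDiff_two (hF : ContDiff ℝ 2 F) (p q : Fin 3 × Fin 3) :
    Continuous (pderiv p (pderiv q F)) :=
  ((contDiff_one_pderiv hF q).continuous_fderiv one_ne_zero).clm_apply continuous_const

/-- Leibniz rule for `∂_p` of a product of differentiable functions. [cite: Agmon1982, (1.16)] -/
theorem pderiv_mul (hχ : Differentiable ℝ χ) (hF : Differentiable ℝ F) (p : Fin 3 × Fin 3) (x : ZM) :
    pderiv p (χ * F) x = pderiv p χ x * F x + χ x * pderiv p F x := by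
  have h1 : HasLineDerivAt ℝ (χ * F) (pderiv p (χ * F) x) x (unitDir p) :=
    hasLineDerivAt_pderiv (hχ.mul hF) x p
  have h2 : HasLineDerivAt ℝ (fun y => χ y * F y) (pderiv p χ x * F x + χ x * pderiv p F x) x (unitDir p) :=
    hasLineDerivAt_mul₂ (hasLineDerivAt_pderiv hχ x p) (hasLineDerivAt_pderiv hF x p)
  exact h1.unique h2

/-- Outside the topological support of a test function its partials vanish. [cite: Agmon1982, Thm. 1.5] -/
theorem pderiv_eq_zero_of_notMem_tsupport {x : ZM} (hx : x ∉ tsupport χ) (p : Fin 3 × Fin 3) :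
    pderiv p χ x = 0 := by
  simp [pderiv, fderiv_of_notMem_tsupport ℝ hx]

/-- A continuous function vanishing off the (compact) support of a test function is integrable.
[cite: Agmon1982, Thm. 1.5] -/
private theorem integrable_of_eq_zero_off (hχ : IsTestFn χ) {u : ZM → ℝ} (hu : Continuous u)
    (h0 : ∀ x, x ∉ tsupport χ → u x = 0) : Integrable u :=
  hu.integrable_of_hasCompactSupport (HasCompactSupport.intro hχ.2 h0)

/-! ### 2. The one-coordinate integration by parts -/

/-- **No-boundary-term integration by parts in the coordinate `p`**: for `χ ∈ C²_c` and `F ∈ C²`,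
`∫ [χ² (∂_pF)² + F · (2χ ∂_pχ ∂_pF + χ² ∂_p∂_pF)] dx = 0`
(i.e. `∫ χ²(∂_pF)² = −∫ F ∂_p(χ² ∂_pF)`). [cite: Agmon1982, (1.16)–(1.16″)] -/
theorem integral_cutoff_ibp (hχ : IsTestFn χ) (hF : ContDiff ℝ 2 F) (p : Fin 3 × Fin 3) :
    ∫ x, (χ x ^ 2 * (pderiv p F x) ^ 2
      + F x * (2 * χ x * pderiv p χ x * pderiv p F x + χ x ^ 2 * pderiv p (pderiv p F) x)) = 0 := by
  have hχc := hχ.continuous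
  have hχd := hχ.differentiable
  have hdχc := hχ.continuous_pderiv p
  have hFd := differentiable_of_contDiff_two hF
  have hFc : Continuous F := hF.continuous
  have hdFc := continuous_pderiv_of_contDiff_two hF p
  have hdFd := differentiable_pderiv_of_contDiff_two hF p
  have hddFc := continuous_pderiv_pderiv_of_contDiff_two hF p p
  have hχ0 : ∀ x, x ∉ tsupport χ → χ x = 0 := fun x hx => image_eq_zero_of_notMem_tsupport hx
  -- the three integrability conditions of the Mathlib integration-by-parts lemma
  have I1 : Integrable (fun x => pderiv p F x * (χ x ^ 2 * pderiv p F x)) :=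
    integrable_of_eq_zero_off hχ (hdFc.mul ((hχc.pow 2).mul hdFc)) fun x hx => by simp [hχ0 x hx]
  have I2 : Integrable (fun x => F x *
      (2 * χ x * pderiv p χ x * pderiv p F x + χ x ^ 2 * pderiv p (pderiv p F) x)) :=
    integrable_of_eq_zero_off hχ
      (hFc.mul ((((continuous_const.mul hχc).mul hdχc).mul hdFc).add ((hχc.pow 2).mul hddFc)))
      fun x hx => by simp [hχ0 x hx]
  have I3 : Integrable (fun x => F x * (χ x ^ 2 * pderiv p F x)) :=
    integrable_of_eq_zero_off hχ (hFc.mul ((hχc.pow 2).mul hdFc)) fun x hx => by simp [hχ0 x hx]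
  have I4 : Integrable (fun x => χ x ^ 2 * (pderiv p F x) ^ 2) :=
    integrable_of_eq_zero_off hχ ((hχc.pow 2).mul (hdFc.pow 2)) fun x hx => by simp [hχ0 x hx]
  -- line derivatives: F along e_p, and g = χ² ∂_pF along e_p
  have hf : ∀ x ∈ tsupport (fun x => χ x ^ 2 * pderiv p F x),
      HasLineDerivAt ℝ F (pderiv p F x) x (unitDir p) := fun x _ => hasLineDerivAt_pderiv hFd x p
  have hg : ∀ x ∈ tsupport F, HasLineDerivAt ℝ (fun y => χ y ^ 2 * pderiv p F y)
      (2 * χ x * pderiv p χ x * pderiv p F x + χ x ^ 2 * pderiv p (pderiv p F) x) x (unitDir p) := by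
    intro x _
    have h1 : HasLineDerivAt ℝ (fun y => χ y * χ y) (pderiv p χ x * χ x + χ x * pderiv p χ x) x (unitDir p) :=
      hasLineDerivAt_mul₂ (hasLineDerivAt_pderiv hχd x p) (hasLineDerivAt_pderiv hχd x p)
    have h2 : HasLineDerivAt ℝ (pderiv p F) (pderiv p (pderiv p F) x) x (unitDir p) :=
      hasLineDerivAt_pderiv hdFd x p
    have h3 := hasLineDerivAt_mul₂ h1 h2
    have e1 : (fun y => χ y ^ 2 * pderiv p F y) = fun y => χ y * χ y * pderiv p F y := by
      funext y; rw [sq]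
    rw [e1]
    convert h3 using 1
    ring
  have key := integral_bilinear_hasLineDerivAt_right_eq_neg_left_of_integrable (μ := volume)
    (B := ContinuousLinearMap.mul ℝ ℝ) (f := F) (f' := pderiv p F)
    (g := fun x => χ x ^ 2 * pderiv p F x)
    (g' := fun x => 2 * χ x * pderiv p χ x * pderiv p F x + χ x ^ 2 * pderiv p (pderiv p F) x)
    (v := unitDir p)
    (by simpa only [ContinuousLinearMap.mul_apply'] using I1)
    (by simpa only [ContinuousLinearMap.mul_apply'] using I2)
    (by simpa only [ContinuousLinearMap.mul_apply'] using I3)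
    hf hg
  simp only [ContinuousLinearMap.mul_apply'] at key
  -- key : ∫ F·g' = −∫ ∂F·(χ²∂F)
  have e2 : ∫ x, pderiv p F x * (χ x ^ 2 * pderiv p F x) = ∫ x, χ x ^ 2 * (pderiv p F x) ^ 2 :=
    integral_congr_ae (Eventually.of_forall fun x => by ring)
  rw [integral_add I4 I2, key, e2]
  ring

/-! ### 3. The cut-off energy identity -/

/-- **Agmon's localisation identity for the matrix-model form** (`χ ∈ C²_c`, `F ∈ C²`):
`𝔮(χF) = ∫ χ² F · (−½ΔF + V F) + ½ ∫ ‖∇χ‖² F²`, `ΔF = Σ_p ∂_p∂_pF` —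
pointwise `½|∇(χF)|² + Vχ²F² − χ²F(−½ΔF+VF) − ½|∇χ|²F² = Σ_p [χF∂_pχ∂_pF + ½χ²(∂_pF)² + ½χ²F∂_p∂_pF]`,
whose integral vanishes coordinate by coordinate (`integral_cutoff_ibp`). [cite: Agmon1982, (1.16)–(1.16″)] -/
theorem energyForm_testFn_mul (hχ : IsTestFn χ) (hF : ContDiff ℝ 2 F) :
    energyForm (χ * F) =
      (∫ x, χ x ^ 2 * (F x * (-(1 / 2 : ℝ) * (∑ p, pderiv p (pderiv p F) x) + luscherPotential x * F x)))
        + (1 / 2 : ℝ) * ∫ x, ‖gradient χ x‖ ^ 2 * F x ^ 2 := by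
  have hχc := hχ.continuous
  have hχd := hχ.differentiable
  have hdχc := hχ.continuous_pderiv
  have hFd := differentiable_of_contDiff_two hF
  have hFc : Continuous F := hF.continuous
  have hdFc := continuous_pderiv_of_contDiff_two hF
  have hddFc := continuous_pderiv_pderiv_of_contDiff_two hF
  have hVc : Continuous luscherPotential := continuous_luscherPotential
  have hχ0 : ∀ x, x ∉ tsupport χ → χ x = 0 := fun x hx => image_eq_zero_of_notMem_tsupport hx
  have hdχ0 : ∀ x, x ∉ tsupport χ → ∀ p, pderiv p χ x = 0 :=
    fun x hx p => pderiv_eq_zero_of_notMem_tsupport hx p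
  -- the integrands
  set l : ZM → ℝ := fun x => (1 / 2 : ℝ) * ∑ p, (pderiv p χ x * F x + χ x * pderiv p F x) ^ 2
    + luscherPotential x * (χ x * F x) ^ 2 with hl
  set r₁ : ZM → ℝ := fun x =>
    χ x ^ 2 * (F x * (-(1 / 2 : ℝ) * (∑ p, pderiv p (pderiv p F) x) + luscherPotential x * F x)) with hr₁
  set r₂ : ZM → ℝ := fun x => (∑ p, (pderiv p χ x) ^ 2) * F x ^ 2 with hr₂
  set e : Fin 3 × Fin 3 → ZM → ℝ := fun p x => (1 / 2 : ℝ) * (χ x ^ 2 * (pderiv p F x) ^ 2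
      + F x * (2 * χ x * pderiv p χ x * pderiv p F x + χ x ^ 2 * pderiv p (pderiv p F) x)) with he
  -- Step 1: rewrite both sides with these integrands
  have eL : energyForm (χ * F) = ∫ x, l x := by
    unfold energyForm
    refine integral_congr_ae (Eventually.of_forall fun x => ?_)
    simp only [hl, norm_gradient_sq, pderiv_mul hχd hFd, Pi.mul_apply]
  have eR₂ : ∫ x, ‖gradient χ x‖ ^ 2 * F x ^ 2 = ∫ x, r₂ x :=
    integral_congr_ae (Eventually.of_forall fun x => by simp only [hr₂, norm_gradient_sq])
  rw [eL, eR₂]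
  -- Step 2: integrability of l, r₁, r₂, e p
  have hsumc : Continuous fun x => ∑ p, (pderiv p χ x * F x + χ x * pderiv p F x) ^ 2 :=
    continuous_finsetSum _ fun p _ => (((hdχc p).mul hFc).add (hχc.mul (hdFc p))).pow 2
  have hlap : Continuous fun x => ∑ p, pderiv p (pderiv p F) x :=
    continuous_finsetSum _ fun p _ => hddFc p p
  have Il : Integrable l :=
    integrable_of_eq_zero_off hχ ((continuous_const.mul hsumc).add (hVc.mul ((hχc.mul hFc).pow 2)))
      fun x hx => by simp [hl, hχ0 x hx, hdχ0 x hx]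
  have Ir₁ : Integrable r₁ :=
    integrable_of_eq_zero_off hχ
      ((hχc.pow 2).mul (hFc.mul (((continuous_const.mul hlap)).add (hVc.mul hFc))))
      fun x hx => by simp [hr₁, hχ0 x hx]
  have Ir₂ : Integrable r₂ :=
    integrable_of_eq_zero_off hχ ((continuous_finsetSum _ fun p _ => (hdχc p).pow 2).mul (hFc.pow 2))
      fun x hx => by simp [hr₂, hdχ0 x hx]
  have Ie : ∀ p, Integrable (e p) := fun p =>
    integrable_of_eq_zero_off hχ
      (continuous_const.mul (((hχc.pow 2).mul ((hdFc p).pow 2)).add (hFc.mul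
        ((((continuous_const.mul hχc).mul (hdχc p)).mul (hdFc p)).add ((hχc.pow 2).mul (hddFc p p))))))
      fun x hx => by simp [he, hχ0 x hx]
  -- Step 3: ∫ e p = 0 for every p (integration by parts), hence ∫ Σ_p e p = 0
  have he0 : ∀ p, ∫ x, e p x = 0 := fun p => by
    simp only [he]
    rw [integral_const_mul, integral_cutoff_ibp hχ hF p, mul_zero]
  have hsum0 : ∫ x, ∑ p, e p x = 0 := by
    rw [integral_finsetSum _ fun p _ => Ie p]
    exact Finset.sum_eq_zero fun p _ => he0 p
  -- Step 4: pointwise, l − (r₁ + ½ r₂) = Σ_p e p (expand the nine coordinates and use `ring`)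
  have hpt : ∀ x, l x - (r₁ x + (1 / 2 : ℝ) * r₂ x) = ∑ p, e p x := by
    intro x
    simp only [hl, hr₁, hr₂, he, Fintype.sum_prod_type, Fin.sum_univ_three]
    ring
  -- Step 5: conclude
  have I2' : Integrable (fun x => (1 / 2 : ℝ) * r₂ x) := Ir₂.const_mul _
  have I12 : Integrable (fun x => r₁ x + (1 / 2 : ℝ) * r₂ x) := Ir₁.add I2'
  have h1 : ∫ x, (l x - (r₁ x + (1 / 2 : ℝ) * r₂ x)) = (∫ x, l x) - ∫ x, (r₁ x + (1 / 2 : ℝ) * r₂ x) :=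
    integral_sub Il I12
  have h2 : ∫ x, (r₁ x + (1 / 2 : ℝ) * r₂ x) = (∫ x, r₁ x) + ∫ x, (1 / 2 : ℝ) * r₂ x := integral_add Ir₁ I2'
  have h3 : ∫ x, (1 / 2 : ℝ) * r₂ x = (1 / 2 : ℝ) * ∫ x, r₂ x := integral_const_mul _ _
  have h4 : ∫ x, (l x - (r₁ x + (1 / 2 : ℝ) * r₂ x)) = 0 :=
    (integral_congr_ae (Eventually.of_forall hpt)).trans hsum0
  linarith

/-- **Energy of a cut-off classical eigenfunction**: if `F ∈ C²` satisfies `−½ΔF + VF = E·F` pointwise, then for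
every `χ ∈ C²_c`,  `𝔮(χF) = E ∫ χ²F² + ½ ∫ ‖∇χ‖² F²`  (`= E‖χF‖² +` the localisation cost).
[cite: Agmon1982, (1.16″)] -/
theorem energyForm_testFn_mul_of_eigen (hχ : IsTestFn χ) (hF : ContDiff ℝ 2 F) {E : ℝ}
    (hE : ∀ x : ZM, -(1 / 2 : ℝ) * (∑ p, pderiv p (pderiv p F) x) + luscherPotential x * F x = E * F x) :
    energyForm (χ * F) = E * (∫ x, χ x ^ 2 * F x ^ 2) + (1 / 2 : ℝ) * ∫ x, ‖gradient χ x‖ ^ 2 * F x ^ 2 := by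
  rw [energyForm_testFn_mul hχ hF, ← integral_const_mul (μ := volume) E (fun x => χ x ^ 2 * F x ^ 2)]
  congr 1
  refine integral_congr_ae (Eventually.of_forall fun x => ?_)
  simp only [hE x]
  ring

/-- The `L²` mass of the cut-off function: `l2sq (χF) = ∫ χ² F²`. [cite: Agmon1982, (1.16″)] -/
theorem l2sq_testFn_mul (χ F : ZM → ℝ) : l2sq (χ * F) = ∫ x, χ x ^ 2 * F x ^ 2 := by
  unfold l2sq
  exact integral_congr_ae (Eventually.of_forall fun x => by simp only [Pi.mul_apply, mul_pow])

/-! ### 4. Quasimode energies of the eigenfunctions of the named fact `LuscherHamiltonianEigenfunctions` -/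

/-- A function that is `C^n` for every finite `n` is `C²`. [cite: Agmon1982, Thm. 1.5] -/
theorem contDiff_two_of_forall {ψ : ZM → ℝ} (h : ∀ n : ℕ∞, ContDiff ℝ n ψ) : ContDiff ℝ 2 ψ := h 2

/-- The eigen-equation clause of the fact, `hApply F = E·F`, in the explicit form used by
`energyForm_testFn_mul_of_eigen`. [cite: Agmon1982, (1.16″)] -/
theorem hApply_eq_iff {ψ : ZM → ℝ} {E : ℝ} (x : ZM) :
    hApply ψ x = E * ψ x ↔
      -(1 / 2 : ℝ) * (∑ p, pderiv p (pderiv p ψ) x) + luscherPotential x * ψ x = E * ψ x := by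
  rw [hApply_def, laplacian_def]

/-- **Energy of a cut-off eigenfunction of the fact.**  For smooth `f_j` with `hApply f_j = E_j f_j` pointwise,
`E_j = physLevel (j+1)` (the clauses of `LuscherHamiltonianEigenfunctions k`), and any `C²_c` cut-off `χ`:
`𝔮(χ f_j) = E_j ∫ χ² f_j² + ½ ∫ ‖∇χ‖² f_j²`. [cite: Agmon1982, (1.16)–(1.16″)] -/
theorem energyForm_testFn_mul_eigenfunction {k : ℕ} {f : Fin (k + 1) → ZM → ℝ}
    (hsmooth : ∀ j, ∀ n : ℕ∞, ContDiff ℝ n (f j))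
    (heig : ∀ j, ∀ x : ZM, hApply (f j) x = physLevel ((j : ℕ) + 1) * f j x)
    (hχ : IsTestFn χ) (j : Fin (k + 1)) :
    energyForm (χ * f j) =
      physLevel ((j : ℕ) + 1) * (∫ x, χ x ^ 2 * f j x ^ 2) + (1 / 2 : ℝ) * ∫ x, ‖gradient χ x‖ ^ 2 * f j x ^ 2 :=
  energyForm_testFn_mul_of_eigen hχ (contDiff_two_of_forall (hsmooth j))
    fun x => (hApply_eq_iff x).mp (heig j x)

/-- The same with the `L²` mass written as `l2sq (χ f_j)`: `𝔮(χ f_j) = E_j · l2sq(χ f_j) + ½ ∫ ‖∇χ‖² f_j²`.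
[cite: Agmon1982, (1.16″)] -/
theorem energyForm_testFn_mul_eigenfunction' {k : ℕ} {f : Fin (k + 1) → ZM → ℝ}
    (hsmooth : ∀ j, ∀ n : ℕ∞, ContDiff ℝ n (f j))
    (heig : ∀ j, ∀ x : ZM, hApply (f j) x = physLevel ((j : ℕ) + 1) * f j x)
    (hχ : IsTestFn χ) (j : Fin (k + 1)) :
    energyForm (χ * f j) =
      physLevel ((j : ℕ) + 1) * l2sq (χ * f j) + (1 / 2 : ℝ) * ∫ x, ‖gradient χ x‖ ^ 2 * f j x ^ 2 := by
  rw [l2sq_testFn_mul]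
  exact energyForm_testFn_mul_eigenfunction hsmooth heig hχ j

/-- Unpacking the named fact together with the cut-off identity: under `LuscherHamiltonianEigenfunctions k` there
are `k+1` smooth, colour-invariant, `L²`-orthonormal, exponentially decaying classical eigenfunctions whose cut-offs by
any `χ ∈ C²_c` have energy `physLevel (j+1) · l2sq(χ f_j) + ½ ∫ ‖∇χ‖² f_j²`.
[cite: ReedSimonIV1978, Thm. XIII.64] [cite: Agmon1982, (1.16″)] -/
theorem LuscherHamiltonianEigenfunctions.exists_cutoff_energy {k : ℕ} (h : LuscherHamiltonianEigenfunctions k) :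
    ∃ f : Fin (k + 1) → ZM → ℝ,
      (∀ j, ∀ n : ℕ∞, ContDiff ℝ n (f j)) ∧ (∀ j, IsGaugeInv (f j)) ∧
      (∀ i j, ∫ x, f i x * f j x = if i = j then (1 : ℝ) else 0) ∧
      (∀ j, ∀ x : ZM, hApply (f j) x = physLevel ((j : ℕ) + 1) * f j x) ∧
      (∀ j, ExpDecay₂ (f j)) ∧
      ∀ χ : ZM → ℝ, IsTestFn χ → ∀ j,
        energyForm (χ * f j) =
          physLevel ((j : ℕ) + 1) * l2sq (χ * f j) + (1 / 2 : ℝ) * ∫ x, ‖gradient χ x‖ ^ 2 * f j x ^ 2 := by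
  obtain ⟨f, hsmooth, hinv, horth, heig, hdec⟩ := h
  exact ⟨f, hsmooth, hinv, horth, heig, hdec,
    fun χ hχ j => energyForm_testFn_mul_eigenfunction' hsmooth heig hχ j⟩

/-! ### 5. The span of cut-off eigenfunctions (quasimode space) -/

section Span

variable {k : ℕ} {f : Fin (k + 1) → ZM → ℝ} {χ : ZM → ℝ}

/-- `∂_p` of a finite linear combination of differentiable functions. [cite: Agmon1982, (1.16)] -/
theorem pderiv_sum_mul (hf : ∀ j, Differentiable ℝ (f j)) (a : Fin (k + 1) → ℝ) (p : Fin 3 × Fin 3) (x : ZM) :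
    pderiv p (fun y => ∑ j, a j * f j y) x = ∑ j, a j * pderiv p (f j) x := by
  have h1 : HasLineDerivAt ℝ (fun y => ∑ j, a j * f j y) (pderiv p (fun y => ∑ j, a j * f j y) x) x (unitDir p) :=
    hasLineDerivAt_pderiv (Differentiable.fun_sum fun j _ => (hf j).const_mul (a j)) x p
  have h2 : HasLineDerivAt ℝ (fun y => ∑ j, a j * f j y) (∑ j, a j * pderiv p (f j) x) x (unitDir p) := by
    unfold HasLineDerivAt
    exact HasDerivAt.fun_sum fun j _ =>
      (hasLineDerivAt_pderiv (hf j) x p : HasDerivAt (fun t : ℝ => f j (x + t • unitDir p)) _ 0).const_mul (a j)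
  exact h1.unique h2

/-- A finite linear combination of `C^n` functions is `C^n`. [cite: Agmon1982, Thm. 1.5] -/
theorem contDiff_sum_mul {n : WithTop ℕ∞} (hf : ∀ j, ContDiff ℝ n (f j)) (a : Fin (k + 1) → ℝ) :
    ContDiff ℝ n (fun y => ∑ j, a j * f j y) :=
  ContDiff.sum fun j _ => contDiff_const.mul (hf j)

/-- Second partials of a finite linear combination of `C²` functions. [cite: Agmon1982, (1.16)] -/
theorem pderiv_pderiv_sum_mul (hf : ∀ j, ContDiff ℝ 2 (f j)) (a : Fin (k + 1) → ℝ) (p q : Fin 3 × Fin 3)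
    (x : ZM) :
    pderiv p (pderiv q (fun y => ∑ j, a j * f j y)) x = ∑ j, a j * pderiv p (pderiv q (f j)) x := by
  have e : pderiv q (fun y => ∑ j, a j * f j y) = fun y => ∑ j, a j * pderiv q (f j) y :=
    funext fun y => pderiv_sum_mul (fun j => differentiable_of_contDiff_two (hf j)) a q y
  rw [e]
  exact pderiv_sum_mul (fun j => differentiable_pderiv_of_contDiff_two (hf j) q) a p x

/-- **Linearity of `𝔥` on `C²` functions**: `𝔥(Σ_j a_j f_j) = Σ_j a_j 𝔥 f_j` pointwise. [cite: Agmon1982, (1.16)] -/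
theorem hApply_sum_mul (hf : ∀ j, ContDiff ℝ 2 (f j)) (a : Fin (k + 1) → ℝ) (x : ZM) :
    hApply (fun y => ∑ j, a j * f j y) x = ∑ j, a j * hApply (f j) x := by
  simp only [hApply_def, laplacian_def, pderiv_pderiv_sum_mul hf a]
  rw [Finset.sum_comm]
  calc -(1 / 2 : ℝ) * ∑ j, ∑ p, a j * pderiv p (pderiv p (f j)) x + luscherPotential x * ∑ j, a j * f j x
      = ∑ j, (-(1 / 2 : ℝ) * ∑ p, a j * pderiv p (pderiv p (f j)) x) + ∑ j, luscherPotential x * (a j * f j x) := by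
        rw [Finset.mul_sum, Finset.mul_sum]
    _ = ∑ j, ((-(1 / 2 : ℝ) * ∑ p, a j * pderiv p (pderiv p (f j)) x) + luscherPotential x * (a j * f j x)) :=
        Finset.sum_add_distrib.symm
    _ = ∑ j, a j * (-(1 / 2 : ℝ) * (∑ p, pderiv p (pderiv p (f j)) x) + luscherPotential x * f j x) :=
        Finset.sum_congr rfl fun j _ => by rw [← Finset.mul_sum]; ring

/-- Expanding a weighted product of two linear combinations under the integral:
`∫ w (Σ_i a_i f_i)(Σ_j b_j f_j) = Σ_{i,j} a_i b_j ∫ w f_i f_j` for a continuous weight `w` vanishing off the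
support of the cut-off. [cite: Agmon1982, (1.16″)] -/
private theorem integral_weight_span_span (hχ : IsTestFn χ) {w : ZM → ℝ} (hw : Continuous w)
    (hw0 : ∀ x, x ∉ tsupport χ → w x = 0) (hfc : ∀ j, Continuous (f j)) (a b : Fin (k + 1) → ℝ) :
    ∫ x, w x * ((∑ i, a i * f i x) * ∑ j, b j * f j x) =
      ∑ i, ∑ j, a i * b j * ∫ x, w x * (f i x * f j x) := by
  have Iij : ∀ i j, Integrable (fun x => w x * (f i x * f j x)) := fun i j =>
    integrable_of_eq_zero_off hχ (hw.mul ((hfc i).mul (hfc j))) fun x hx => by simp [hw0 x hx]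
  have e : ∀ x, w x * ((∑ i, a i * f i x) * ∑ j, b j * f j x) =
      ∑ i, ∑ j, a i * b j * (w x * (f i x * f j x)) := by
    intro x
    rw [Finset.sum_mul_sum, Finset.mul_sum]
    refine Finset.sum_congr rfl fun i _ => ?_
    rw [Finset.mul_sum]
    exact Finset.sum_congr rfl fun j _ => by ring
  rw [integral_congr_ae (Eventually.of_forall e),
    integral_finsetSum _ fun i _ => integrable_finsetSum _ fun j _ => (Iij i j).const_mul _]
  refine Finset.sum_congr rfl fun i _ => ?_
  rw [integral_finsetSum _ fun j _ => (Iij i j).const_mul _]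
  exact Finset.sum_congr rfl fun j _ => integral_const_mul _ _

/-- The `L²` mass of the cut-off span: `l2sq(χ Σ_j a_j f_j) = Σ_{i,j} a_i a_j ∫ χ² f_i f_j`.
[cite: Agmon1982, (1.16″)] -/
theorem l2sq_testFn_mul_span (hχ : IsTestFn χ) (hfc : ∀ j, Continuous (f j)) (a : Fin (k + 1) → ℝ) :
    l2sq (χ * fun x => ∑ j, a j * f j x) = ∑ i, ∑ j, a i * a j * ∫ x, χ x ^ 2 * (f i x * f j x) := by
  rw [l2sq_testFn_mul]
  have e : ∫ x, χ x ^ 2 * (∑ j, a j * f j x) ^ 2 = ∫ x, χ x ^ 2 * ((∑ i, a i * f i x) * ∑ j, a j * f j x) :=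
    integral_congr_ae (Eventually.of_forall fun x => by simp only [sq])
  rw [e]
  exact integral_weight_span_span hχ (hχ.continuous.pow 2)
    (fun x hx => by simp [image_eq_zero_of_notMem_tsupport hx]) hfc a a

/-- **Energy of the cut-off span**: for smooth classical eigenfunctions `hApply f_j = E_j f_j` and
`F_a = Σ_j a_j f_j`, `𝔮(χ F_a) = Σ_{i,j} a_i a_j (E_j ∫ χ² f_i f_j + ½ ∫ ‖∇χ‖² f_i f_j)`.
[cite: Agmon1982, (1.16)–(1.16″)] -/
theorem energyForm_testFn_mul_span (hχ : IsTestFn χ) (hsmooth : ∀ j, ∀ n : ℕ∞, ContDiff ℝ n (f j))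
    {Ev : Fin (k + 1) → ℝ} (heig : ∀ j, ∀ x : ZM, hApply (f j) x = Ev j * f j x) (a : Fin (k + 1) → ℝ) :
    energyForm (χ * fun x => ∑ j, a j * f j x) =
      ∑ i, ∑ j, a i * a j * ((Ev j * ∫ x, χ x ^ 2 * (f i x * f j x))
        + (1 / 2 : ℝ) * ∫ x, ‖gradient χ x‖ ^ 2 * (f i x * f j x)) := by
  have h2 : ∀ j, ContDiff ℝ 2 (f j) := fun j => contDiff_two_of_forall (hsmooth j)
  have hfc : ∀ j, Continuous (f j) := fun j => (h2 j).continuous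
  rw [energyForm_testFn_mul hχ (contDiff_sum_mul h2 a)]
  -- the `𝔥`-term: −½ΔF_a + VF_a = Σ_j a_j E_j f_j
  have e1 : ∀ x, -(1 / 2 : ℝ) * (∑ p, pderiv p (pderiv p (fun y => ∑ j, a j * f j y)) x)
      + luscherPotential x * (∑ j, a j * f j x) = ∑ j, (a j * Ev j) * f j x := by
    intro x
    rw [← laplacian_def, ← hApply_def, hApply_sum_mul h2 a x]
    exact Finset.sum_congr rfl fun j _ => by rw [heig j x]; ring
  have e2 : ∫ x, χ x ^ 2 * ((∑ j, a j * f j x) * (-(1 / 2 : ℝ) *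
        (∑ p, pderiv p (pderiv p (fun y => ∑ j, a j * f j y)) x) + luscherPotential x * ∑ j, a j * f j x)) =
      ∫ x, χ x ^ 2 * ((∑ i, a i * f i x) * ∑ j, (a j * Ev j) * f j x) :=
    integral_congr_ae (Eventually.of_forall fun x => by simp only [e1 x])
  -- the `|∇χ|²`-term as a weight vanishing off the support
  have e3 : ∫ x, ‖gradient χ x‖ ^ 2 * (∑ j, a j * f j x) ^ 2 =
      ∫ x, (∑ p, (pderiv p χ x) ^ 2) * ((∑ i, a i * f i x) * ∑ j, a j * f j x) :=
    integral_congr_ae (Eventually.of_forall fun x => by simp only [norm_gradient_sq]; ring)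
  have hw : Continuous fun x => ∑ p, (pderiv p χ x) ^ 2 :=
    continuous_finsetSum _ fun p _ => (hχ.continuous_pderiv p).pow 2
  have hw0 : ∀ x, x ∉ tsupport χ → (∑ p, (pderiv p χ x) ^ 2) = 0 := fun x hx => by
    simp [pderiv_eq_zero_of_notMem_tsupport hx]
  rw [e2, e3, integral_weight_span_span hχ (w := fun x => χ x ^ 2) (hχ.continuous.pow 2)
      (fun x hx => by simp [image_eq_zero_of_notMem_tsupport hx]) hfc a (fun j => a j * Ev j),
    integral_weight_span_span hχ hw hw0 hfc a a, Finset.mul_sum, ← Finset.sum_add_distrib]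
  refine Finset.sum_congr rfl fun i _ => ?_
  rw [Finset.mul_sum, ← Finset.sum_add_distrib]
  refine Finset.sum_congr rfl fun j _ => ?_
  have e4 : ∫ x, (∑ p, (pderiv p χ x) ^ 2) * (f i x * f j x) = ∫ x, ‖gradient χ x‖ ^ 2 * (f i x * f j x) :=
    integral_congr_ae (Eventually.of_forall fun x => by simp only [norm_gradient_sq])
  rw [e4]
  ring

/-- The products `f_i f_j` of an `L²`-orthonormal family of continuous functions are integrable (diagonal: the
normalisation `∫ f_j² = 1 ≠ 0` forces it; off-diagonal: `|f_i f_j| ≤ ½(f_i² + f_j²)`).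
[cite: ReedSimonIV1978, Thm. XIII.64] -/
theorem integrable_mul_of_orthonormal (hfc : ∀ j, Continuous (f j))
    (horth : ∀ i j, ∫ x, f i x * f j x = if i = j then (1 : ℝ) else 0) (i j : Fin (k + 1)) :
    Integrable (fun x => f i x * f j x) := by
  have hdiag : ∀ j, Integrable (fun x => f j x * f j x) := fun j => by
    by_contra h
    have := horth j j
    rw [integral_undef h, if_pos rfl] at this
    norm_num at this
  have hsum : Integrable (fun x => (f i x * f i x + f j x * f j x) / 2) :=
    ((hdiag i).add (hdiag j)).div_const 2
  refine hsum.mono' ((hfc i).mul (hfc j)).aestronglyMeasurable (Eventually.of_forall fun x => ?_)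
  rw [Real.norm_eq_abs, abs_mul]
  nlinarith [sq_nonneg (|f i x| - |f j x|), abs_mul_abs_self (f i x), abs_mul_abs_self (f j x),
    abs_nonneg (f i x), abs_nonneg (f j x)]

/-- **Gram identity of the cut-off family**: `∫ χ² f_i f_j = δ_ij − ∫ (1 − χ²) f_i f_j` for an `L²`-orthonormal
family (the "almost orthonormality" of cut-off eigenfunctions, Helffer's (4.2.13)).
[cite: ReedSimonIV1978, Thm. XIII.64] [cite: Agmon1982, (1.16″)] -/
theorem integral_sq_mul_mul_eq_of_orthonormal (hχ : IsTestFn χ) (hfc : ∀ j, Continuous (f j))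
    (horth : ∀ i j, ∫ x, f i x * f j x = if i = j then (1 : ℝ) else 0) (i j : Fin (k + 1)) :
    ∫ x, χ x ^ 2 * (f i x * f j x) =
      (if i = j then (1 : ℝ) else 0) - ∫ x, (1 - χ x ^ 2) * (f i x * f j x) := by
  have I1 : Integrable (fun x => f i x * f j x) := integrable_mul_of_orthonormal hfc horth i j
  have I2 : Integrable (fun x => χ x ^ 2 * (f i x * f j x)) :=
    integrable_of_eq_zero_off hχ ((hχ.continuous.pow 2).mul ((hfc i).mul (hfc j)))
      fun x hx => by simp [image_eq_zero_of_notMem_tsupport hx]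
  have e : ∫ x, (1 - χ x ^ 2) * (f i x * f j x) = (∫ x, f i x * f j x) - ∫ x, χ x ^ 2 * (f i x * f j x) := by
    rw [← integral_sub I1 I2]
    exact integral_congr_ae (Eventually.of_forall fun x => by ring)
  rw [e, horth i j]
  ring

/-- Elementary: `A T − |A| c⁻¹…` — the termwise estimate behind the quasimode bound: for `c ≥ 0`,
`A c T + ½ A D ≤ |A| (c |T| + ½ |D|)`. [cite: Agmon1982, (1.16″)] -/
private theorem term_le (A T D : ℝ) {c : ℝ} (hc : 0 ≤ c) :
    A * c * T + (1 / 2 : ℝ) * (A * D) ≤ |A| * (c * |T| + (1 / 2 : ℝ) * |D|) := by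
  have h1 : A * T ≤ |A| * |T| := by rw [← abs_mul]; exact le_abs_self _
  have h2 : A * D ≤ |A| * |D| := by rw [← abs_mul]; exact le_abs_self _
  nlinarith

/-- **Quasimode Rayleigh bound for the cut-off span** (Helffer's Prop. 4.1.1/Thm. 4.2.1 in the tree's vocabulary):
for smooth `L²`-orthonormal classical eigenfunctions `f_0,…,f_k` with eigenvalues `E_j ≤ E`, any `C²_c` cut-off
`χ` and any coefficients `a`, writing `F_a = Σ_j a_j f_j`, `T_ij = ∫(1−χ²) f_i f_j`, `D_ij = ∫ ‖∇χ‖² f_i f_j`: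
`𝔮(χ F_a) ≤ E · l2sq(χ F_a) + Σ_{i,j} |a_i| |a_j| ((E − E_j)|T_ij| + ½ |D_ij|)` —
the Rayleigh quotient of every function in the `(k+1)`-dimensional trial space is `≤ E` up to the exponentially small
tails `T`, `D` (small by `ExpDecay₂` once `χ = 1` on a large ball). [cite: Agmon1982, (1.16″)] [cite: ReedSimonIV1978, Thm. XIII.1] -/
theorem energyForm_span_le (hχ : IsTestFn χ) (hsmooth : ∀ j, ∀ n : ℕ∞, ContDiff ℝ n (f j))
    (horth : ∀ i j, ∫ x, f i x * f j x = if i = j then (1 : ℝ) else 0)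
    {Ev : Fin (k + 1) → ℝ} (heig : ∀ j, ∀ x : ZM, hApply (f j) x = Ev j * f j x)
    {E : ℝ} (hE : ∀ j, Ev j ≤ E) (a : Fin (k + 1) → ℝ) :
    energyForm (χ * fun x => ∑ j, a j * f j x) ≤
      E * l2sq (χ * fun x => ∑ j, a j * f j x)
        + ∑ i, ∑ j, |a i| * |a j| * ((E - Ev j) * |∫ x, (1 - χ x ^ 2) * (f i x * f j x)|
            + (1 / 2 : ℝ) * |∫ x, ‖gradient χ x‖ ^ 2 * (f i x * f j x)|) := by
  have hfc : ∀ j, Continuous (f j) := fun j => (contDiff_two_of_forall (hsmooth j)).continuous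
  rw [energyForm_testFn_mul_span hχ hsmooth heig a, l2sq_testFn_mul_span hχ hfc a]
  -- termwise inequality, with the diagonal defect `a_j² (E_j − E) ≤ 0` kept explicit
  have key : ∀ i j,
      a i * a j * ((Ev j * ∫ x, χ x ^ 2 * (f i x * f j x))
          + (1 / 2 : ℝ) * ∫ x, ‖gradient χ x‖ ^ 2 * (f i x * f j x))
        ≤ E * (a i * a j * ∫ x, χ x ^ 2 * (f i x * f j x))
          + |a i| * |a j| * ((E - Ev j) * |∫ x, (1 - χ x ^ 2) * (f i x * f j x)|
              + (1 / 2 : ℝ) * |∫ x, ‖gradient χ x‖ ^ 2 * (f i x * f j x)|)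
          + (if i = j then a j ^ 2 * (Ev j - E) else 0) := by
    intro i j
    rw [integral_sq_mul_mul_eq_of_orthonormal hχ hfc horth i j]
    have h := term_le (a i * a j) (∫ x, (1 - χ x ^ 2) * (f i x * f j x))
      (∫ x, ‖gradient χ x‖ ^ 2 * (f i x * f j x)) (sub_nonneg.mpr (hE j))
    rw [abs_mul] at h
    by_cases hij : i = j
    · subst hij
      simp only [if_true]
      nlinarith [h]
    · simp only [if_neg hij]
      nlinarith [h]
  have hdiag : ∑ i : Fin (k + 1), ∑ j : Fin (k + 1), (if i = j then a j ^ 2 * (Ev j - E) else 0) ≤ 0 := by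
    refine Finset.sum_nonpos fun i _ => ?_
    rw [Finset.sum_ite_eq, if_pos (Finset.mem_univ i)]
    exact mul_nonpos_of_nonneg_of_nonpos (sq_nonneg _) (sub_nonpos.mpr (hE i))
  have total := Finset.sum_le_sum fun i (_ : i ∈ (Finset.univ : Finset (Fin (k + 1)))) =>
    Finset.sum_le_sum fun j (_ : j ∈ (Finset.univ : Finset (Fin (k + 1)))) => key i j
  have split : ∑ i, ∑ j, (E * (a i * a j * ∫ x, χ x ^ 2 * (f i x * f j x))
          + |a i| * |a j| * ((E - Ev j) * |∫ x, (1 - χ x ^ 2) * (f i x * f j x)|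
              + (1 / 2 : ℝ) * |∫ x, ‖gradient χ x‖ ^ 2 * (f i x * f j x)|)
          + (if i = j then a j ^ 2 * (Ev j - E) else 0))
      = E * (∑ i, ∑ j, a i * a j * ∫ x, χ x ^ 2 * (f i x * f j x))
        + ∑ i, ∑ j, |a i| * |a j| * ((E - Ev j) * |∫ x, (1 - χ x ^ 2) * (f i x * f j x)|
              + (1 / 2 : ℝ) * |∫ x, ‖gradient χ x‖ ^ 2 * (f i x * f j x)|)
        + ∑ i : Fin (k + 1), ∑ j : Fin (k + 1), (if i = j then a j ^ 2 * (Ev j - E) else 0) := by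
    simp only [Finset.mul_sum, Finset.sum_add_distrib]
  rw [split] at total
  linarith [hdiag]

/-- **Non-degeneracy of the trial space**: `Σ_j a_j² − Σ_{i,j} |a_i||a_j| |T_ij| ≤ l2sq(χ F_a)`, `T_ij = ∫(1−χ²) f_i f_j`
— so the cut-off span is `(k+1)`-dimensional as soon as the tails are `< 1/(k+1)`-small.
[cite: Agmon1982, (1.16″)] [cite: ReedSimonIV1978, Thm. XIII.1] -/
theorem sum_sq_sub_le_l2sq_span (hχ : IsTestFn χ) (hfc : ∀ j, Continuous (f j))
    (horth : ∀ i j, ∫ x, f i x * f j x = if i = j then (1 : ℝ) else 0) (a : Fin (k + 1) → ℝ) :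
    ∑ j, a j ^ 2 - ∑ i, ∑ j, |a i| * |a j| * |∫ x, (1 - χ x ^ 2) * (f i x * f j x)| ≤
      l2sq (χ * fun x => ∑ j, a j * f j x) := by
  rw [l2sq_testFn_mul_span hχ hfc a]
  have key : ∀ i j, (if i = j then a j ^ 2 else 0) - |a i| * |a j| * |∫ x, (1 - χ x ^ 2) * (f i x * f j x)|
      ≤ a i * a j * ∫ x, χ x ^ 2 * (f i x * f j x) := by
    intro i j
    rw [integral_sq_mul_mul_eq_of_orthonormal hχ hfc horth i j]
    have h : a i * a j * ∫ x, (1 - χ x ^ 2) * (f i x * f j x) ≤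
        |a i| * |a j| * |∫ x, (1 - χ x ^ 2) * (f i x * f j x)| := by
      rw [← abs_mul, ← abs_mul]; exact le_abs_self _
    by_cases hij : i = j
    · subst hij; simp only [if_true]; nlinarith [h]
    · simp only [if_neg hij]; nlinarith [h]
  have hdiag : ∑ i : Fin (k + 1), ∑ j : Fin (k + 1), (if i = j then a j ^ 2 else 0) = ∑ j, a j ^ 2 :=
    Finset.sum_congr rfl fun i _ => by rw [Finset.sum_ite_eq, if_pos (Finset.mem_univ i)]
  calc ∑ j, a j ^ 2 - ∑ i, ∑ j, |a i| * |a j| * |∫ x, (1 - χ x ^ 2) * (f i x * f j x)|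
      = ∑ i, ∑ j, ((if i = j then a j ^ 2 else 0)
          - |a i| * |a j| * |∫ x, (1 - χ x ^ 2) * (f i x * f j x)|) := by
        rw [← hdiag, ← Finset.sum_sub_distrib]
        exact Finset.sum_congr rfl fun i _ => (Finset.sum_sub_distrib ..).symm
    _ ≤ ∑ i, ∑ j, a i * a j * ∫ x, χ x ^ 2 * (f i x * f j x) :=
        Finset.sum_le_sum fun i _ => Finset.sum_le_sum fun j _ => key i j

/-- The quasimode bound for the eigenfunctions of the named fact, with `E = physLevel (k+1)` (the levels are
monotone, `physLevel_mono`): for every `a`,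
`𝔮(χ F_a) ≤ physLevel(k+1) · l2sq(χ F_a) + Σ_{i,j}|a_i||a_j|((physLevel(k+1) − physLevel(j+1))|T_ij| + ½|D_ij|)`.
[cite: Agmon1982, (1.16″)] [cite: ReedSimonIV1978, Thm. XIII.1] -/
theorem energyForm_span_le_physLevel (hχ : IsTestFn χ) (hsmooth : ∀ j, ∀ n : ℕ∞, ContDiff ℝ n (f j))
    (horth : ∀ i j, ∫ x, f i x * f j x = if i = j then (1 : ℝ) else 0)
    (heig : ∀ j, ∀ x : ZM, hApply (f j) x = physLevel ((j : ℕ) + 1) * f j x) (a : Fin (k + 1) → ℝ) :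
    energyForm (χ * fun x => ∑ j, a j * f j x) ≤
      physLevel (k + 1) * l2sq (χ * fun x => ∑ j, a j * f j x)
        + ∑ i, ∑ j, |a i| * |a j| *
            ((physLevel (k + 1) - physLevel ((j : ℕ) + 1)) * |∫ x, (1 - χ x ^ 2) * (f i x * f j x)|
              + (1 / 2 : ℝ) * |∫ x, ‖gradient χ x‖ ^ 2 * (f i x * f j x)|) :=
  energyForm_span_le hχ hsmooth horth (Ev := fun j => physLevel ((j : ℕ) + 1)) heig
    (fun j => physLevel_mono (Nat.succ_le_succ (Nat.zero_le _)) (Nat.succ_le_succ (Nat.le_of_lt_succ j.2))) a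

end Span

/-! ### 6. Exponential tails: the cut-off errors are `O(e^{−R})` -/

section Tails

variable {k : ℕ} {f : Fin (k + 1) → ZM → ℝ} {χ : ZM → ℝ}

/-- `x ↦ e^{−‖x‖}` is integrable on `ℝ⁹` (domination by `e·10!·(1+‖x‖)^{−10}`, and `(1+‖x‖)^{−r} ∈ L¹` for
`r > 9 = dim`). [cite: Agmon1982, Cor. 4.5] -/
theorem integrable_exp_neg_norm : Integrable (fun x : ZM => Real.exp (-‖x‖)) := by
  have hdim : (Module.finrank ℝ ZM : ℝ) < 10 := by
    rw [finrank_euclideanSpace, Fintype.card_prod, Fintype.card_fin]; norm_num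
  have hI : Integrable (fun x : ZM => (Real.exp 1 * (Nat.factorial 10 : ℝ)) * (1 + ‖x‖) ^ (-(10 : ℝ))) :=
    (integrable_one_add_norm hdim).const_mul _
  refine hI.mono' (Real.continuous_exp.comp continuous_norm.neg).aestronglyMeasurable
    (Eventually.of_forall fun x => ?_)
  rw [Real.norm_eq_abs, abs_of_pos (Real.exp_pos _)]
  have hpos : 0 < 1 + ‖x‖ := by positivity
  have hP : 0 < (1 + ‖x‖) ^ 10 := pow_pos hpos 10
  -- (1+s)^10 ≤ 10! · e · e^s
  have h1 : (1 + ‖x‖) ^ 10 / (Nat.factorial 10 : ℝ) ≤ Real.exp (1 + ‖x‖) :=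
    Real.pow_div_factorial_le_exp _ hpos.le 10
  have h2 : (1 + ‖x‖) ^ 10 ≤ (Nat.factorial 10 : ℝ) * (Real.exp 1 * Real.exp ‖x‖) := by
    rw [← Real.exp_add]
    rw [div_le_iff₀ (by positivity)] at h1
    linarith
  have h3 : Real.exp (-‖x‖) * (1 + ‖x‖) ^ 10 ≤ Real.exp 1 * (Nat.factorial 10 : ℝ) := by
    have h := mul_le_mul_of_nonneg_left h2 (Real.exp_pos (-‖x‖)).le
    calc Real.exp (-‖x‖) * (1 + ‖x‖) ^ 10
        ≤ Real.exp (-‖x‖) * ((Nat.factorial 10 : ℝ) * (Real.exp 1 * Real.exp ‖x‖)) := h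
      _ = Real.exp 1 * (Nat.factorial 10 : ℝ) * (Real.exp (-‖x‖) * Real.exp ‖x‖) := by ring
      _ = Real.exp 1 * (Nat.factorial 10 : ℝ) := by
          rw [← Real.exp_add, neg_add_cancel, Real.exp_zero, mul_one]
  have e : (1 + ‖x‖) ^ (-(10 : ℝ)) = ((1 + ‖x‖) ^ 10)⁻¹ := by
    rw [Real.rpow_neg hpos.le, show (10 : ℝ) = ((10 : ℕ) : ℝ) by norm_num, Real.rpow_natCast]
  rw [e]
  calc Real.exp (-‖x‖) = Real.exp (-‖x‖) * (1 + ‖x‖) ^ 10 * ((1 + ‖x‖) ^ 10)⁻¹ := by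
        rw [mul_assoc, mul_inv_cancel₀ hP.ne', mul_one]
    _ ≤ Real.exp 1 * (Nat.factorial 10 : ℝ) * ((1 + ‖x‖) ^ 10)⁻¹ :=
        mul_le_mul_of_nonneg_right h3 (inv_nonneg.mpr hP.le)

/-- **Tail bound from exponential decay.**  If `|f_i| ≤ C_i e^{−‖x‖}`, `|f_j| ≤ C_j e^{−‖x‖}` and the weight `w` is
bounded by `M` and vanishes on the ball `‖x‖ < R` (no measurability needed: a non-integrable integrand has
integral `0`), then
`|∫ w f_i f_j| ≤ M C_i C_j e^{−R} ∫ e^{−‖x‖}` (pointwise `e^{−2‖x‖} ≤ e^{−R} e^{−‖x‖}` off the ball).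
[cite: Agmon1982, Cor. 4.5, Thm. 5.1] -/
theorem abs_integral_weight_mul_mul_le {fi fj w : ZM → ℝ} {Ci Cj M R : ℝ}
    (hi : ∀ x, |fi x| ≤ Ci * Real.exp (-‖x‖)) (hj : ∀ x, |fj x| ≤ Cj * Real.exp (-‖x‖))
    (hM : ∀ x, |w x| ≤ M) (hR : ∀ x : ZM, ‖x‖ < R → w x = 0) :
    |∫ x, w x * (fi x * fj x)| ≤ M * Ci * Cj * Real.exp (-R) * ∫ x : ZM, Real.exp (-‖x‖) := by
  have hM0 : 0 ≤ M := (abs_nonneg _).trans (hM 0)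
  have hCi : 0 ≤ Ci := by
    have h := (abs_nonneg _).trans (hi 0)
    rw [norm_zero, neg_zero, Real.exp_zero, mul_one] at h; exact h
  have hCj : 0 ≤ Cj := by
    have h := (abs_nonneg _).trans (hj 0)
    rw [norm_zero, neg_zero, Real.exp_zero, mul_one] at h; exact h
  have hK : 0 ≤ M * Ci * Cj * Real.exp (-R) := by positivity
  -- pointwise bound
  have hpt : ∀ x, ‖w x * (fi x * fj x)‖ ≤ M * Ci * Cj * Real.exp (-R) * Real.exp (-‖x‖) := by
    intro x
    rw [Real.norm_eq_abs]
    by_cases hx : ‖x‖ < R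
    · rw [hR x hx, zero_mul, abs_zero]; positivity
    · rw [not_lt] at hx
      have e1 : Real.exp (-‖x‖) * Real.exp (-‖x‖) ≤ Real.exp (-R) * Real.exp (-‖x‖) :=
        mul_le_mul_of_nonneg_right (Real.exp_le_exp.mpr (neg_le_neg hx)) (Real.exp_pos _).le
      rw [abs_mul, abs_mul]
      calc |w x| * (|fi x| * |fj x|)
          ≤ M * ((Ci * Real.exp (-‖x‖)) * (Cj * Real.exp (-‖x‖))) :=
            mul_le_mul (hM x) (mul_le_mul (hi x) (hj x) (abs_nonneg _) (by positivity)) (by positivity) hM0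
        _ = M * Ci * Cj * (Real.exp (-‖x‖) * Real.exp (-‖x‖)) := by ring
        _ ≤ M * Ci * Cj * (Real.exp (-R) * Real.exp (-‖x‖)) :=
            mul_le_mul_of_nonneg_left e1 (by positivity)
        _ = M * Ci * Cj * Real.exp (-R) * Real.exp (-‖x‖) := by ring
  have h := norm_integral_le_of_norm_le (integrable_exp_neg_norm.const_mul (M * Ci * Cj * Real.exp (-R)))
    (Eventually.of_forall hpt)
  rw [integral_const_mul, Real.norm_eq_abs] at h
  exact h

/-- Unpacking `ExpDecay₂`: a nonnegative constant with `|ψ| ≤ C e^{−‖x‖}`. [cite: Agmon1982, Cor. 4.5] -/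
theorem ExpDecay₂.exists_abs_le {ψ : ZM → ℝ} (h : ExpDecay₂ ψ) :
    ∃ C : ℝ, 0 ≤ C ∧ ∀ x : ZM, |ψ x| ≤ C * Real.exp (-‖x‖) := by
  obtain ⟨C, hC0, hC⟩ := h.exists_nonneg
  exact ⟨C, hC0, fun x => (hC x).1⟩

/-- **The mass tail `T_ij = ∫ (1 − χ²) f_i f_j` is `O(e^{−R})`** when the cut-off satisfies `|1 − χ²| ≤ M` and
`χ = 1` on the ball `‖x‖ < R`, for `f_i, f_j` with `|f| ≤ C e^{−‖x‖}`:
`|T_ij| ≤ M C_i C_j e^{−R} ∫ e^{−‖x‖}`. [cite: Agmon1982, Cor. 4.5] -/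
theorem abs_tail_le {fi fj : ZM → ℝ} {Ci Cj M R : ℝ}
    (hi : ∀ x, |fi x| ≤ Ci * Real.exp (-‖x‖)) (hj : ∀ x, |fj x| ≤ Cj * Real.exp (-‖x‖))
    (hM : ∀ x, |1 - χ x ^ 2| ≤ M) (hR : ∀ x : ZM, ‖x‖ < R → χ x = 1) :
    |∫ x, (1 - χ x ^ 2) * (fi x * fj x)| ≤ M * Ci * Cj * Real.exp (-R) * ∫ x : ZM, Real.exp (-‖x‖) :=
  abs_integral_weight_mul_mul_le hi hj hM (fun x hx => by rw [hR x hx]; norm_num)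

/-- Inside the ball where `χ ≡ 1` the gradient weight vanishes: `‖∇χ(x)‖² = 0` for `‖x‖ < R`.
[cite: Agmon1982, (1.16)] -/
theorem norm_gradient_sq_eq_zero_of_eq_one {R : ℝ} (hR : ∀ x : ZM, ‖x‖ < R → χ x = 1) {x : ZM} (hx : ‖x‖ < R) :
    ‖gradient χ x‖ ^ 2 = 0 := by
  have hev : χ =ᶠ[𝓝 x] fun _ => (1 : ℝ) := by
    have hopen : IsOpen (Metric.ball (0 : ZM) R) := Metric.isOpen_ball
    have hxmem : x ∈ Metric.ball (0 : ZM) R := mem_ball_zero_iff.mpr hx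
    exact Filter.eventually_of_mem (hopen.mem_nhds hxmem) fun y hy => hR y (mem_ball_zero_iff.mp hy)
  have hfd : fderiv ℝ χ x = 0 := by
    rw [hev.fderiv_eq]
    exact fderiv_const_apply (1 : ℝ)
  rw [norm_gradient_sq]
  refine Finset.sum_eq_zero fun p _ => ?_
  simp [pderiv, hfd]

/-- **The gradient tail `D_ij = ∫ ‖∇χ‖² f_i f_j` is `O(e^{−R})`** when `‖∇χ‖² ≤ M'` and `χ = 1` on `‖x‖ < R`:
`|D_ij| ≤ M' C_i C_j e^{−R} ∫ e^{−‖x‖}`. [cite: Agmon1982, Cor. 4.5] -/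
theorem abs_gradTail_le {fi fj : ZM → ℝ} {Ci Cj M' R : ℝ}
    (hi : ∀ x, |fi x| ≤ Ci * Real.exp (-‖x‖)) (hj : ∀ x, |fj x| ≤ Cj * Real.exp (-‖x‖))
    (hM : ∀ x, ‖gradient χ x‖ ^ 2 ≤ M') (hR : ∀ x : ZM, ‖x‖ < R → χ x = 1) :
    |∫ x, ‖gradient χ x‖ ^ 2 * (fi x * fj x)| ≤ M' * Ci * Cj * Real.exp (-R) * ∫ x : ZM, Real.exp (-‖x‖) :=
  abs_integral_weight_mul_mul_le hi hj (fun x => by rw [abs_of_nonneg (sq_nonneg _)]; exact hM x)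
    (fun x hx => norm_gradient_sq_eq_zero_of_eq_one hR hx)

end Tails

end CutoffEnergy

end Literature.Analysis.OperatorTheory.YMMatrixModel

end
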